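import Summits.Ventures.PercRepro.Night2ThreeTwoObstructionThirteen

/-!
# PercRepro — the cell `(3, 2)`: the complement of a member in `G` spans `V` (night-2, gen 26)

Groundwork for the obstruction cells with `|V| ≤ 10`.  A member `B ⊆ G` of the cell has `ρ(E ∖ B) = 7` while the three
points of `E ∖ G` contribute at most `3`, so `G ∖ B` has rank `≥ 4`: the part of `V` outside `B` SPANS `V`.  For a face
`K ∪ (T ∖ w)` of a covering basis `K ∪ T` this says that `V ∖ (T ∖ w)` — the point `w`, the points off the face plane
and the points of the face plane other than the three basis points — is not coplanar.  On the nested instances with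
`|V| = 8` this condition kills the faces whose complement is a line plus a point (e.g. `V = ℓ ∪ {p₁, p₂, p₃}` with
`|ℓ| = 5`, `T = {a, b, p₁, p₂}`: `V ∖ {a, p₁, p₂} = (ℓ ∖ a) ∪ {p₃}` is coplanar), which is why the measured basis losses
there are `1/20` against the chord `2/5`.

* **`four_le_rkN_sdiff_of_mem_Uq`**: `rkN (G ∖ B) ≥ 4` for a member `B ⊆ G` of the cell (`d = 3`);
* `four_le_rkN_sdiff_coloops_of_mem_Uq`: the same for `V ∖ B = (G ∖ B) ∖ K`, for a member containing `K`.
-/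

namespace PercRepro.Shadow

open Finset PerFlat ThmH

variable {α : Type*} [DecidableEq α] {M : Matroid α} [M.Finite]

section SpanCondition

variable {G : Finset α}

/-- **THE COMPLEMENT OF A MEMBER SPANS**: a member `B ⊆ G` of the cell `d = 3` has `rkN (G ∖ B) ≥ 4`
(`7 = ρ(E ∖ B) ≤ ρ(E ∖ G) + ρ(G ∖ B) ≤ 3 + ρ(G ∖ B)`). -/
theorem four_le_rkN_sdiff_of_mem_Uq (hG : G ∈ flatsQ M (5 + 1)) (hd : (gr M \ G).card = 3) {B : Finset α}
    (hB : B ∈ Uq M (5 + 2) 5) (hBG : B ⊆ G) : 4 ≤ rkN M (G \ B) := by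
  have hGg : G ⊆ gr M := (mem_flatsQ.1 hG).1
  obtain ⟨-, -, h7⟩ := mem_Uq.1 hB
  have h7' : rkN M (gr M \ B) = 7 := by
    rw [eRk_eq_rkN] at h7
    exact_mod_cast h7
  have hunion : gr M \ B = (gr M \ G) ∪ (G \ B) := by
    ext a
    simp only [Finset.mem_sdiff, Finset.mem_union]
    constructor
    · rintro ⟨hag, haB⟩
      by_cases haG : a ∈ G
      · exact Or.inr ⟨haG, haB⟩
      · exact Or.inl ⟨hag, haG⟩
    · rintro (⟨hag, haG⟩ | ⟨haG, haB⟩)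
      · exact ⟨hag, fun h => haG (hBG h)⟩
      · exact ⟨hGg haG, haB⟩
  have hsub := rkN_submod (M := M) (gr M \ G) (G \ B)
  have hD : rkN M (gr M \ G) ≤ 3 := by
    have := rkN_le_card (M := M) (gr M \ G)
    omega
  rw [← hunion, h7'] at hsub
  omega

/-- The same for the part off the coloops: a member `B ⊆ G` containing `K` has `rkN ((G ∖ B) ∖ K) ≥ 4`
(`G ∖ B` misses `K` already). -/
theorem four_le_rkN_sdiff_coloops_of_mem_Uq (hG : G ∈ flatsQ M (5 + 1)) (hd : (gr M \ G).card = 3)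
    {B : Finset α} (hB : B ∈ Uq M (5 + 2) 5) (hBG : B ⊆ G) (hKB : coloops M G ⊆ B) :
    4 ≤ rkN M ((G \ coloops M G) \ B) := by
  have h := four_le_rkN_sdiff_of_mem_Uq hG hd hB hBG
  have he : (G \ coloops M G) \ B = G \ B := by
    ext a
    simp only [Finset.mem_sdiff]
    exact ⟨fun h => ⟨h.1.1, h.2⟩, fun h => ⟨⟨h.1, fun hK => h.2 (hKB hK)⟩, h.2⟩⟩
  rwa [he]

open scoped Classical in
/-- **A face whose omitted point lies in the closure of `V ∖ T` is not a member**: for `Q = K ∪ T ⊆ G` with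
`K = coloops`, `w ∈ T` and `w ∈ cl (V ∖ T)`, the face `Q.erase w` is not in `Uq` — its complement in `G` is
`(V ∖ T) ∪ {w}`, of the rank of `V ∖ T ≤ 3`. -/
theorem face_notMem_Uq_of_mem_clF (hG : G ∈ flatsQ M (5 + 1)) (hd : (gr M \ G).card = 3)
    {T : Finset α} (hT : T ⊆ G \ coloops M G) {w : α} (hw : w ∈ T)
    (hr : rkN M ((G \ coloops M G) \ T) ≤ 3) (hcl : w ∈ clF M ((G \ coloops M G) \ T)) :
    (coloops M G ∪ T).erase w ∉ Uq M (5 + 2) 5 := by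
  intro hB
  have hGg : G ⊆ gr M := (mem_flatsQ.1 hG).1
  have hKG : coloops M G ⊆ G := fun y hy => (mem_coloops.1 hy).1
  have hBG : (coloops M G ∪ T).erase w ⊆ G :=
    (Finset.erase_subset w _).trans (Finset.union_subset hKG (hT.trans Finset.sdiff_subset))
  have h4 := four_le_rkN_sdiff_of_mem_Uq hG hd hB hBG
  have hwK : w ∉ coloops M G := (Finset.mem_sdiff.1 (hT hw)).2
  have he : G \ (coloops M G ∪ T).erase w = insert w ((G \ coloops M G) \ T) := by
    ext a
    simp only [Finset.mem_sdiff, Finset.mem_erase, Finset.mem_union, Finset.mem_insert, not_and, not_or]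
    constructor
    · rintro ⟨haG, h⟩
      by_cases haw : a = w
      · exact Or.inl haw
      · have h' := h haw
        exact Or.inr ⟨⟨haG, h'.1⟩, h'.2⟩
    · rintro (rfl | ⟨⟨haG, haK⟩, haT⟩)
      · exact ⟨(Finset.mem_sdiff.1 (hT hw)).1, fun h => absurd rfl h⟩
      · exact ⟨haG, fun _ => ⟨haK, haT⟩⟩
  rw [he] at h4
  have hsub : (G \ coloops M G) \ T ⊆ gr M := Finset.sdiff_subset.trans (Finset.sdiff_subset.trans hGg)
  have := rkN_insert_le_of_mem_clF hsub hcl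
  omega

open scoped Classical in
/-- **A covering basis whose complement in `V` has rank `≤ 2` loses nothing**: none of its faces is a member. -/
theorem faceLoss_eq_zero_of_rkN_le_two (hG : G ∈ flatsQ M (5 + 1)) (hd : (gr M \ G).card = 3)
    {T : Finset α} (hT : T ⊆ G \ coloops M G) (hr : rkN M ((G \ coloops M G) \ T) ≤ 2) {w : α} (hw : w ∈ T) :
    faceLoss M 5 G (coloops M G ∪ T) w = 0 := by
  unfold faceLoss
  rw [if_neg]
  rintro ⟨hthin, -⟩
  have hB : (coloops M G ∪ T).erase w ∈ Uq M (5 + 2) 5 := (mem_membersIn.1 (mem_thinMembers.1 hthin).1).1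
  have hGg : G ⊆ gr M := (mem_flatsQ.1 hG).1
  have hKG : coloops M G ⊆ G := fun y hy => (mem_coloops.1 hy).1
  have hBG : (coloops M G ∪ T).erase w ⊆ G :=
    (Finset.erase_subset w _).trans (Finset.union_subset hKG (hT.trans Finset.sdiff_subset))
  have h4 := four_le_rkN_sdiff_of_mem_Uq hG hd hB hBG
  have hsub : G \ (coloops M G ∪ T).erase w ⊆ insert w ((G \ coloops M G) \ T) := by
    intro a ha
    simp only [Finset.mem_sdiff, Finset.mem_erase, Finset.mem_union, not_and, not_or] at ha
    rw [Finset.mem_insert, Finset.mem_sdiff, Finset.mem_sdiff]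
    by_cases haw : a = w
    · exact Or.inl haw
    · exact Or.inr ⟨⟨ha.1, (ha.2 haw).1⟩, (ha.2 haw).2⟩
  have h1 := rkN_mono (M := M) hsub
  have h2 : rkN M (insert w ((G \ coloops M G) \ T)) ≤ rkN M ((G \ coloops M G) \ T) + 1 := by
    have := rkN_le_card (M := M) (insert w ((G \ coloops M G) \ T))
    by_cases hmem : w ∈ clF M ((G \ coloops M G) \ T)
    · have := rkN_insert_le_of_mem_clF (Finset.sdiff_subset.trans (Finset.sdiff_subset.trans hGg)) hmem
      omega
    · have := rkN_insert_of_notMem_clF (hGg (Finset.mem_sdiff.1 (hT hw)).1) hmem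
      omega
  omega

end SpanCondition

end PercRepro.Shadow
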